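import Summits.BirchSwinnertonDyer.BirchSwinnertonDyer.Theorems.SchneiderFreeAdditiveX3KrizLiHypothesisOneAutomaticDoor
import HarnessLib

/-!
# LINE PRESENTATIONS of a reducible `E[p]` (a rational `p`-line `⟨T⟩`, its isogeny character `r`, a PRIMITIVE Dirichlet character `φ` with
# `r = φ ∘ χ_f`, `f ∣ (p·N)^∞`) and the PER-LINE form of the Kriz–Li road on the K1 door at `p ≥ 5`: the Bernoulli obligation ranges over the
# Teichmüller lifts of the isogeny characters ONLY (route `SchneiderFreeAdditiveX3`, Kriz–Li corner)

Cell `bsd-schneider-ideate`, seat `bsd-schneider-door-c5` (prover, generation 37; `--supports` 19177 as helper).  PARTITION: board row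
B6 ∩ X3 ∩ sst-twist, `r = 1`, both cells at `p ≥ 5` — the KRIZ–LI SUB-LOCUS; types-the-object-of nothing new; closes none of B6's cells;
BSD NOT advanced; «closes rung: none».  bears_on: K1-door (19177).

WHY.  This seat's `KrizLiOneAutomaticDoor.missingLowerBoundAt_of_printedFacts_of_thm120_of_forall_bernoulli_five_le` (p746121) asks for a
Bernoulli certificate «for every admissible character datum» — every primitive `ψ` with the trace form at all good primes.  Without
Chebotarev + Brauer–Nesbitt the kernel cannot see that these are just the (two) Jordan–Hölder characters, so that hypothesis is not finitely
checkable per pair.  This file re-keys the obligation to LINE PRESENTATIONS `(T, r, f, φ)` — the isogeny character of a rational `p`-line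
written as a primitive Dirichlet character (`exists_linePresentation_of_red`: they exist; generation 36's construction, factored) — whose
Teichmüller lifts automatically have the trace form (§2, Mazur's Prop. 6.3 (1)) and Kriz–Li's (1), (3) (§3, `p ≥ 5`, this seat's F26/F28):
the per-pair Bernoulli obligation now ranges over finitely many explicitly known characters.

WHAT.  §1 `exists_linePresentation_of_red`; §2 `traceForm_teichmullerLift_of_linePresentation` (ANY line presentation, ANY Teichmüller `ω`);
§3 `h1_h3_of_linePresentation` (on the door at `p ≥ 5`: `p ∣ f`, (1), (3) for the lift of ANY line presentation); §4
**`missingLowerBoundAt_of_printedFacts_of_thm120_of_forall_linePresentation_five_le`** — the lower half of BSD_p at a door pair with `p ≥ 5`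
from `PrintedFacts` + Kriz–Li Thm. 1.20 + (2) + «for every line presentation and Teichmüller `ω`: a Heegner field (odd `d_K`), its Kronecker
character and the Bernoulli pair (4) for `ψ = ω ∘ φ`».

HONEST FRAMING: §1–§3 UNCONDITIONAL tree theorems (no definition, no named fact, no `sorry`); §4 CONDITIONAL on its displayed PUBLISHED named
facts (`PrintedFacts`, Kriz–Li Thm. 1.20) and per-pair hypotheses (2), (4); nothing is closed; r2/r3 untouched; BSD is proved for no curve;
«closes rung: none».  References: [KrizLi2019] Thm. 1.20 (pp. 7–8), §2; [Mazur1978] §5, Prop. 6.3 (1); [Washington1997] Thm. 14.1, Ch. 3,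
§5.1; [Serre1972] §1.11–1.12; this seat p743469, p744748, p745846, p746121.
-/

set_option autoImplicit false
-- `Summit.<P>.<Sub>` repeats `BirchSwinnertonDyer` by the tree's layout convention (D-0017)
set_option linter.dupNamespace false

noncomputable section

open scoped Classical NumberField

open NumberField IsDedekindDomain IsDedekindDomain.HeightOneSpectrum Field WeierstrassCurve
  Literature.NumberTheory.GaloisRepresentations Literature.NumberTheory.EllipticCurves
  Literature.NumberTheory.EllipticCurves.KrizLi2019

namespace Summit.BirchSwinnertonDyer.BirchSwinnertonDyer.Theorems.SchneiderFreeAdditiveX3.KrizLiLineData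

/-! ### §1 Line presentations: a rational `p`-line, its isogeny character, and a primitive Dirichlet character cutting it out -/

/-- **Line presentations exist.**  For `W/ℚ` globally minimal elliptic with `E[p]` reducible: a `Γ_ℚ`-stable line `⟨T⟩ ≤ E[p]` (`T ≠ 0`)
with isogeny character `r` (`σT = r(σ)T`), and a PRIMITIVE Dirichlet character `φ : (ℤ/f)ˣ → 𝔽_pˣ`, `f` supported on `p·N_W`, with
`r = φ ∘ χ_f` (generation 36's construction: Mazur's line and character, Néron–Ogg–Shafarevich off `p·N_W`, Kronecker–Weber with the level on
the ramification, passage to the primitive character).  UNCONDITIONAL. [cite: Mazur1978, §5 (p. 148)] [cite: Washington1997, Thm. 14.1 and Ch. 3] -/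
theorem exists_linePresentation_of_red (W : WeierstrassCurve ℚ) [W.IsElliptic] [W.IsGloballyMinimal] (p : ℕ) [hp : Fact p.Prime]
    (hred : ¬ W.HasIrreducibleModPGaloisRep p) :
    ∃ (T : geomTorsion W (p : ℤ)) (r : absoluteGaloisGroup ℚ →* (ZMod p)ˣ) (f : ℕ) (_ : NeZero f) (φ : DirichletCharacter (ZMod p) f),
      T ≠ 0 ∧ (∀ σ : absoluteGaloisGroup ℚ, σ • T = ((r σ : (ZMod p)ˣ) : ZMod p).val • T) ∧ φ.IsPrimitive ∧
      (∀ q : ℕ, q.Prime → q ∣ f → q ∣ p * W.conductorNorm ℤ) ∧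
      (∀ σ : absoluteGaloisGroup ℚ, φ ((modNCyclotomicCharacter ℚ f σ : (ZMod f)ˣ) : ZMod f) = ((r σ : (ZMod p)ˣ) : ZMod p)) := by
  have hpP : p.Prime := hp.out
  obtain ⟨H, hH, hcard⟩ := (Mazur1978.not_hasIrreducibleModPGaloisRep_iff_exists_natCard_eq W p).mp hred
  obtain ⟨T, hT0, rfl⟩ := Mazur1978.exists_eq_zmultiples_of_natCard_eq W p hcard
  have hst : ∀ σ : absoluteGaloisGroup ℚ, σ • T ∈ AddSubgroup.zmultiples T :=
    fun σ => hH σ T (AddSubgroup.mem_zmultiples T)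
  obtain ⟨r, hr⟩ := Mazur1978.exists_isogenyCharacter W p hT0 hst
  have hker := Mazur1978.isOpen_ker_of_smul_eq W p hT0 hr
  have hgood : ∀ (q : ℕ) [Fact q.Prime], ¬ q ∣ p * W.conductorNorm ℤ → W.HasGoodReductionAtPrime q := by
    intro q _ hqnd
    by_contra hng
    exact hqnd (dvd_mul_of_dvd_right ((W.dvd_conductorNorm_iff_not_hasGoodReductionAtPrime q).mpr hng) p)
  set S : Set ℕ := {q | q.Prime ∧ q ∣ p * W.conductorNorm ℤ} with hSdef
  have hunr : ∀ q : ℕ, q.Prime → q ∉ S → ∀ (v : HeightOneSpectrum (𝓞 ℚ)), Rat.HeightOneSpectrum.natGenerator v = q →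
      ∀ 𝔓 ∈ v.primesAbove, ∀ τ ∈ 𝔓.inertia (absoluteGaloisGroup ℚ), r τ = 1 := by
    intro q hq hqS v hgen 𝔓 h𝔓 τ hτ
    have hqnd : ¬ q ∣ p * W.conductorNorm ℤ := fun h => hqS ⟨hq, h⟩
    have hgoodv : W.HasGoodReductionAt v := by
      haveI hF := Fact.mk (Rat.HeightOneSpectrum.primesEquiv v).2
      refine (hasGoodReductionAtPrime_iff_hasGoodReductionAt_ringOfIntegers v W).mp (hgood _ ?_)
      have hq' : ((Rat.HeightOneSpectrum.primesEquiv v : Nat.Primes) : ℕ) = q := hgen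
      rw [hq']
      exact hqnd
    have hpv : ((p : ℕ) : 𝓞 ℚ) ∉ v.asIdeal := by
      intro hmem
      have h1 : ((Rat.HeightOneSpectrum.primesEquiv v : Nat.Primes) : ℕ) = p := primesEquiv_eq_of_natCast_mem hpP hmem
      have h2 : ((Rat.HeightOneSpectrum.primesEquiv v : Nat.Primes) : ℕ) = q := hgen
      exact hqnd (by rw [← h2, h1]; exact dvd_mul_right p _)
    exact Mazur1978.isogenyCharacter_eq_one_of_mem_inertia W p hT0 hr hgoodv hpv h𝔓 hτ
  obtain ⟨f, hf, φ, hφprim, hfS, hφ⟩ := IsogenyCharacterDirichlet.exists_isPrimitive_zmod_of_character p r hker S hunr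
  exact ⟨T, r, f, hf, φ, hT0, hr, hφprim, fun q hq hqf => (hfS q hq hqf).2, hφ⟩

/-! ### §2 The Teichmüller lift of ANY line presentation has the trace form -/

/-- **The Teichmüller lift of any line presentation has Kriz–Li's trace form**: for `(T, r, f, φ)` as in §1 and any Teichmüller `ω`,
`‖a_ℓ(W) − (ψ(ℓ) + ψ⁻¹(ℓ)ω(ℓ))‖_p < 1` at every prime `ℓ ∤ p·N_W`, `ψ = ω ∘ φ` (Mazur's Prop. 6.3 (1) at an arithmetic Frobenius,
`χ_f(Frob_ℓ) = ℓ`, lifted to `ℚ_p`; generation 36's §4–§5, factored). [cite: Mazur1978, Prop. 6.3 (1) (p. 153)]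
[cite: KrizLi2019, Thm. 1.20 transcription (trace form)] -/
theorem traceForm_teichmullerLift_of_linePresentation (W : WeierstrassCurve ℚ) [W.IsElliptic] [W.IsGloballyMinimal]
    (p : ℕ) [hp : Fact p.Prime] {T : geomTorsion W (p : ℤ)} (hT0 : T ≠ 0) {r : absoluteGaloisGroup ℚ →* (ZMod p)ˣ}
    (hr : ∀ σ : absoluteGaloisGroup ℚ, σ • T = ((r σ : (ZMod p)ˣ) : ZMod p).val • T)
    {f : ℕ} [NeZero f] {φ : DirichletCharacter (ZMod p) f}
    (hfS : ∀ q : ℕ, q.Prime → q ∣ f → q ∣ p * W.conductorNorm ℤ)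
    (hφ : ∀ σ : absoluteGaloisGroup ℚ, φ ((modNCyclotomicCharacter ℚ f σ : (ZMod f)ˣ) : ZMod f) = ((r σ : (ZMod p)ˣ) : ZMod p))
    {ω : DirichletCharacter ℚ_[p] p} (hω : IsTeichmullerCharacter ω) :
    ∀ ℓ : ℕ, ℓ.Prime → ¬ (ℓ ∣ p * W.conductorNorm ℤ) →
      ‖((W.LFunction ℓ : ℤ) : ℚ_[p]) -
          ((MulChar.ofUnitHom (ω.toUnitHom.comp φ.toUnitHom) : DirichletCharacter ℚ_[p] f) (ℓ : ZMod f) +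
            (MulChar.ofUnitHom (ω.toUnitHom.comp φ.toUnitHom) : DirichletCharacter ℚ_[p] f)⁻¹ (ℓ : ZMod f) * ω (ℓ : ZMod p))‖ < 1 := by
  have hpP : p.Prime := hp.out
  have hgood : ∀ (q : ℕ) [Fact q.Prime], ¬ q ∣ p * W.conductorNorm ℤ → W.HasGoodReductionAtPrime q := by
    intro q _ hqnd
    by_contra hng
    exact hqnd (dvd_mul_of_dvd_right ((W.dvd_conductorNorm_iff_not_hasGoodReductionAtPrime q).mpr hng) p)
  intro ℓ hℓ hℓpN
  haveI := Fact.mk hℓ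
  have hℓp : ℓ ≠ p := fun h => hℓpN (by rw [h]; exact dvd_mul_right p _)
  have hpℓ : ¬ p ∣ ℓ := fun h => hℓp ((Nat.prime_dvd_prime_iff_eq hpP hℓ).mp h).symm
  have hgoodℓ : W.HasGoodReductionAtPrime ℓ := hgood ℓ hℓpN
  have hℓf : ¬ ℓ ∣ f := fun h => hℓpN (hfS ℓ hℓ h)
  set v : HeightOneSpectrum (𝓞 ℚ) := Rat.HeightOneSpectrum.primesEquiv.symm ⟨ℓ, hℓ⟩ with hvdef
  have hgen : Rat.HeightOneSpectrum.natGenerator v = ℓ := by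
    change ((Rat.HeightOneSpectrum.primesEquiv v : Nat.Primes) : ℕ) = ℓ
    rw [hvdef, Equiv.apply_symm_apply]
  have hvℓ : ((ℓ : ℕ) : 𝓞 ℚ) ∈ v.asIdeal := by
    have h := Mazur1978.natCast_natGenerator_mem_asIdeal v
    rwa [hgen] at h
  obtain ⟨𝔓, h𝔓⟩ := HeightOneSpectrum.primesAbove_nonempty v
  obtain ⟨φF, hφF⟩ := exists_isArithFrobAt_of_mem_primesAbove_holds (K := ℚ) (v := v) h𝔓
  have htrace := Mazur1978.isogenyCharacter_add_div_eq_frobeniusTrace W p ℓ hℓp hgoodℓ hT0 hr hvℓ h𝔓 hφF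
  have hχ : ((modNCyclotomicCharacter ℚ f φF : (ZMod f)ˣ) : ZMod f) = (ℓ : ℕ) :=
    Literature.NumberTheory.GaloisRepresentations.Rat.modNCyclotomicCharacter_of_isArithFrobAt hℓ hℓf hvℓ h𝔓 hφF
  have hcop : Nat.Coprime ℓ f := (Nat.Prime.coprime_iff_not_dvd hℓ).mpr hℓf
  set xu : (ZMod f)ˣ := ZMod.unitOfCoprime ℓ hcop with hxudef
  have hxu : (xu : ZMod f) = (ℓ : ZMod f) := ZMod.coe_unitOfCoprime ℓ hcop
  set u : (ZMod p)ˣ := r φF with hudef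
  have hφℓ : φ (ℓ : ZMod f) = (u : ZMod p) := by rw [← hχ, hφ φF]
  have hψℓ : (MulChar.ofUnitHom (ω.toUnitHom.comp φ.toUnitHom) : DirichletCharacter ℚ_[p] f) (ℓ : ZMod f) = ω (u : ZMod p) := by
    rw [← hxu, IsogenyCharacterDirichlet.teichmullerLift_coe_unit, hxu, hφℓ]
  have hψℓ' : (MulChar.ofUnitHom (ω.toUnitHom.comp φ.toUnitHom) : DirichletCharacter ℚ_[p] f)⁻¹ (ℓ : ZMod f) = (ω (u : ZMod p))⁻¹ := by
    rw [MulChar.inv_apply_eq_inv', hψℓ]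
  rw [hψℓ, hψℓ', LFunction_apply_prime_eq_frobeniusTrace W ℓ hgoodℓ]
  exact IsogenyCharacterDirichlet.norm_sub_lt_one_of_trace_congr hω u hpℓ (W.frobeniusTrace ℓ) htrace

/-! ### §3 Every line presentation satisfies Kriz–Li's (1) and (3) on the door at `p ≥ 5` -/

open Summit.BirchSwinnertonDyer.Rank1Residual Literature.NumberTheory.EllipticCurves.Rank1Residual in
/-- **Every line presentation satisfies Kriz–Li's (1) and (3) on the K1 door at `p ≥ 5`.**  For `W` globally minimal with `ClassX3 W p`,
`SubSemistableTwist W p`, `p ≥ 5`, a line presentation `(T, r, f, φ)` and a Teichmüller `ω`: `p ∣ f`, `ψ(p) ≠ 1`, `(ψ⁻¹ω)(p) ≠ 1`, and (3) at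
every additive `ℓ ≠ p`, for `ψ = ω ∘ φ` — this seat's inertia witnesses (`KrizLiOneSemistableTwist`, `KrizLiThreeAutomatic`) and Dirichlet
lemmas (`KrizLiOneAutomaticDoor`).  UNCONDITIONAL. [cite: KrizLi2019, Thm. 1.20 hypotheses (1), (3) (p. 7)] [cite: Serre1972, §1.11–1.12]
[cite: SilvermanAEC2009, Thm. VII.6.1] -/
theorem h1_h3_of_linePresentation (W : WeierstrassCurve ℚ) [W.IsElliptic] [W.IsGloballyMinimal] (p : ℕ) [hp : Fact p.Prime]
    (h5 : 5 ≤ p) (hX : ClassX3 W p) (hS : Additive.SubSemistableTwist W p)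
    {T : geomTorsion W (p : ℤ)} (hT0 : T ≠ 0) {r : absoluteGaloisGroup ℚ →* (ZMod p)ˣ}
    (hr : ∀ σ : absoluteGaloisGroup ℚ, σ • T = ((r σ : (ZMod p)ˣ) : ZMod p).val • T)
    {f : ℕ} [NeZero f] {φ : DirichletCharacter (ZMod p) f} (hφprim : φ.IsPrimitive)
    (hφ : ∀ σ : absoluteGaloisGroup ℚ, φ ((modNCyclotomicCharacter ℚ f σ : (ZMod f)ˣ) : ZMod f) = ((r σ : (ZMod p)ˣ) : ZMod p))
    {ω : DirichletCharacter ℚ_[p] p} (hω : IsTeichmullerCharacter ω) :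
    p ∣ f ∧
    ((MulChar.ofUnitHom (ω.toUnitHom.comp φ.toUnitHom) : DirichletCharacter ℚ_[p] f) (p : ZMod f) ≠ 1 ∧
      primVal (invMulOmega (MulChar.ofUnitHom (ω.toUnitHom.comp φ.toUnitHom) : DirichletCharacter ℚ_[p] f) ω) p ≠ 1) ∧
    (∀ ℓ : ℕ, (hℓ : ℓ.Prime) → ℓ ≠ p →
      (haveI := Fact.mk hℓ; ¬ W.HasGoodReductionAtPrime ℓ ∧ ¬ W.HasMultiplicativeReductionAtPrime ℓ) →
      (MulChar.ofUnitHom (ω.toUnitHom.comp φ.toUnitHom) : DirichletCharacter ℚ_[p] f) (ℓ : ZMod f) ≠ 1 ∧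
        primVal (invMulOmega (MulChar.ofUnitHom (ω.toUnitHom.comp φ.toUnitHom) : DirichletCharacter ℚ_[p] f) ω) ℓ ≠ 1) := by
  have hpP : p.Prime := hp.out
  have hψprim := IsogenyCharacterDirichlet.isPrimitive_teichmullerLift hω hφprim
  -- (1): the two inertia witnesses at `p`
  obtain ⟨v, hv, 𝔓, h𝔓, ⟨τa, hτa, hra⟩, ⟨τb, hτb, hrb⟩⟩ :=
    KrizLiOneSemistableTwist.exists_inertia_witnesses_of_classX3_of_subSemistableTwist W h5 hX hS hT0 hr
  have hpf : p ∣ f := KrizLiThreeAutomatic.dvd_level_of_inertia_ne_one hφ hv h𝔓 hτa hra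
  have hcond := KrizLiOneAutomaticDoor.dvd_conductor_invMulOmega_of_inertia_ne_cyclotomic hω hφ hv h𝔓 hτb hrb
  refine ⟨hpf, ⟨?_, ?_⟩, fun ℓ hℓ hℓp hadd => ?_⟩
  · rw [KrizLiThreeAutomatic.apply_natCast_eq_zero_of_dvd_level _ hpP hpf]; exact zero_ne_one
  · rw [KrizLiOneAutomaticDoor.primVal_eq_zero_of_dvd_conductor _ hpP hcond]; exact zero_ne_one
  · -- (3): `r` ramified at the additive `ℓ ≠ p`
    obtain ⟨v', hv', 𝔓', h𝔓', τ, hτ, hrτ⟩ :=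
      KrizLiThreeAutomatic.exists_mem_inertia_isogenyCharacter_ne_one W p h5 hT0 hr hℓ hℓp hadd.1 hadd.2
    have hℓf : ℓ ∣ f := KrizLiThreeAutomatic.dvd_level_of_inertia_ne_one hφ hv' h𝔓' hτ hrτ
    refine ⟨?_, ?_⟩
    · rw [KrizLiThreeAutomatic.apply_natCast_eq_zero_of_dvd_level _ hℓ hℓf]; exact zero_ne_one
    · rw [KrizLiThreeAutomatic.primVal_invMulOmega_eq_zero_of_dvd_level hψprim ω hℓ hℓf hℓp]; exact zero_ne_one

/-! ### §4 The Kriz–Li road at `p ≥ 5`, per LINE PRESENTATION: the Bernoulli obligation ranges over the lifts of isogeny characters only -/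

open Summit.BirchSwinnertonDyer.Rank1Residual Literature.NumberTheory.EllipticCurves.Rank1Residual
  Literature.NumberTheory.EllipticCurves.Rank1Residual.Typed
  Summit.BirchSwinnertonDyer.BirchSwinnertonDyer.Theses.SchneiderFreeAdditiveX3 in
/-- **The Kriz–Li road on the K1 door at `p ≥ 5`, per line presentation.**  For `W/ℚ` globally minimal with `r_an(W) = 1`, `ClassX3 W p`,
`SubSemistableTwist W p`, `p ≥ 5`, and (2) no prime of split multiplicative reduction: if for every line presentation `(T, r, f, φ)` of `W`
at `p` (§1) and every Teichmüller `ω` there are an imaginary quadratic Heegner field `K` of `N_W` with odd `d_K`, its Kronecker character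
`ε_K`, and the Bernoulli pair (4) for `ψ = ω ∘ φ`, then `MissingLowerBoundAt W p` — the lower half of BSD_p at `W`.  The trace form, (1) and
(3) are supplied by §2–§3; then generation 36's `KrizLiLocusLValueFree.missingLowerBoundAt_of_printedFacts_of_thm120_of_heegnerField`.
CONDITIONAL on `hF`, `hKL` (published) and the per-pair hypotheses; closes nothing by name; BSD is NOT advanced.
[cite: KrizLi2019, Thm. 1.20 (pp. 7–8)] [cite: GrossZagier1986, Thm. I.(6.3)] [cite: JetchevSkinnerWan2017, §7.4.1 (arXiv:1512.06894 p. 30)] -/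
theorem missingLowerBoundAt_of_printedFacts_of_thm120_of_forall_linePresentation_five_le (hF : PrintedFacts)
    (hKL : KrizLi2019.thm120_padicLogHeegner_unit_of_bernoulli)
    (W : WeierstrassCurve ℚ) [W.IsElliptic] [W.IsGloballyMinimal] (p : ℕ) [Fact p.Prime]
    (hr : W.analyticRank = 1) (h5 : 5 ≤ p) (hX : ClassX3 W p) (hS : Additive.SubSemistableTwist W p)
    -- (2) no prime of split multiplicative reduction
    (h2 : ∀ ℓ : ℕ, (hℓ : ℓ.Prime) → ¬ (haveI := Fact.mk hℓ; W.HasSplitMultiplicativeReductionAtPrime ℓ))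
    -- for every LINE PRESENTATION (rational `p`-line `⟨T⟩`, isogeny character `r = φ ∘ χ_f`, `φ` primitive, `f ∣ (p·N)^∞`) and every
    -- Teichmüller `ω`: a Heegner field (odd `d_K`), its Kronecker character, and the Bernoulli pair (4) for `ψ = ω ∘ φ`
    (hdat : ∀ (T : geomTorsion W (p : ℤ)) (r : absoluteGaloisGroup ℚ →* (ZMod p)ˣ) (f : ℕ) [NeZero f]
        (φ : DirichletCharacter (ZMod p) f) (ω : DirichletCharacter ℚ_[p] p),
      T ≠ 0 → (∀ σ : absoluteGaloisGroup ℚ, σ • T = ((r σ : (ZMod p)ˣ) : ZMod p).val • T) → φ.IsPrimitive →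
      (∀ q : ℕ, q.Prime → q ∣ f → q ∣ p * W.conductorNorm ℤ) →
      (∀ σ : absoluteGaloisGroup ℚ, φ ((modNCyclotomicCharacter ℚ f σ : (ZMod f)ˣ) : ZMod f) = ((r σ : (ZMod p)ˣ) : ZMod p)) →
      IsTeichmullerCharacter ω →
      ∃ (K : Type) (_ : Field K) (_ : NumberField K) (εK : DirichletCharacter ℚ_[p] (NumberField.discr K).natAbs),
        IsImaginaryQuadratic K ∧ Odd (NumberField.discr K) ∧ SatisfiesHeegnerHypothesis (W.conductorNorm ℤ) K ∧
        IsKroneckerCharacterOf K εK ∧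
        ¬ (‖bernoulliOnePrim (bernoulliCharOne (MulChar.ofUnitHom (ω.toUnitHom.comp φ.toUnitHom) : DirichletCharacter ℚ_[p] f) εK) *
            bernoulliOnePrim (bernoulliCharTwo (MulChar.ofUnitHom (ω.toUnitHom.comp φ.toUnitHom) : DirichletCharacter ℚ_[p] f) εK ω)‖
            ≤ (p : ℝ)⁻¹)) :
    MissingLowerBoundAt W p := by
  have hp2 : p ≠ 2 := by omega
  obtain ⟨T, r, f, hf, φ, hT0, hrT, hφprim, hfS, hφ⟩ := exists_linePresentation_of_red W p hX.1
  obtain ⟨ω, hω⟩ := KrizLi2019.exists_isTeichmullerCharacter (p := p)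
  have hss := traceForm_teichmullerLift_of_linePresentation W p hT0 hrT hfS hφ hω
  obtain ⟨-, ⟨h1, h1'⟩, h3⟩ := h1_h3_of_linePresentation W p h5 hX hS hT0 hrT hφprim hφ hω
  obtain ⟨K, _, _, εK, hK, hodd, hHe, hεK, h4⟩ := hdat T r f φ ω hT0 hrT hφprim hfS hφ hω
  exact KrizLiLocusLValueFree.missingLowerBoundAt_of_printedFacts_of_thm120_of_heegnerField hF hKL W p hr hp2 hX hS
    f _ ω (IsogenyCharacterDirichlet.isPrimitive_teichmullerLift hω hφprim) hω hss h1 h1' h2 h3 K hK hodd hHe εK hεK h4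

end Summit.BirchSwinnertonDyer.BirchSwinnertonDyer.Theorems.SchneiderFreeAdditiveX3.KrizLiLineData

end
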